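/-
Copyright (c) 2026 the pub-hodgecm-mathlib formalisation cell (harness21).  Prover seat hodgecm-mathlib-LH7-p08 (g0) (re-dealt to strike line L3 `stub_N6nsDyadic` by director
s1969 (a)), Track A «(D-RAM) FOUR-FRAME» squad, helper lane on h413 = stmt-HodgeConjecture-24833 (count-neutral).  β-BOARD v1 row R8 ∕ (P5) «H `(2ρ,2ρ,2ρ)`», FILE 4d: the
collapses for the keys `(m, L, m)` (slot 1) and `(L, m, m)` (slot 0) DOWN TO THE BOUNDARY `L − m = 2d − 2`, and the per-lattice values (FILE 4a's collapsed read at `k = 1, 0`).  2026-09-04.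
-/
import Summits.HodgeConjecture.HodgeConjecture.Theorems.F0P3cDyRamLabelledOddCoreHangingCollapsedRead   -- ★ p861966 (this seat, FILE 4a): `labelledOddCount_div_relIndex_coreHanging_eq_of_collapse`
import HarnessLib

/-!
# Crux `H413`, line LH4 «(D-RAM) FOUR-FRAME» — (β) table, β-BOARD row R8 ∕ (P5), FILE 4d: «THE COLLAPSES FOR THE KEYS `(m, L, m)` AND `(L, m, m)` DOWN TO THE BOUNDARY, AND
# THE PER-LATTICE VALUES `w∕2 · ω(D_i)·ω(f·g_α + g_β)·[i = k ∨ 2d−1 ≤ ρ]` AT `k = 1`, `k = 0`»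

Cell `hodgecm-mathlib` (D-0151), FLOOR 0, crux item H413 = `stmt-HodgeConjecture-24833`, route `HCCMUnconditional`; squad F0∕P3c∕LH4.  THEOREMS ONLY (no `def`, no instance, no
notation, no `sorry`, default heartbeats); ★-only imports; lane `--supports stmt-HodgeConjecture-24833 --as helper` (count-neutral); pays NO row, states NO law.

THE MATHEMATICS (this seat's H-ROW DERIVATION v1 e4da7f0103cc4a29 §3, keys `(m, L, m)` and `(L, m, m)`; the weak-letter form of ★ p861702 ∕ ★ p861767 (FILEs 3c ∕ 3e), valid down to
the boundary `s_g = 2d − 2`).  On `S_F` of a core-hanging member (`|u₂ − u₁| ≤ |ϖ|^ρ`, `|f⁻¹(u₂−u₁) + (u₂−u₀)| ≤ |ϖ|^{2ρ}`, hence `|u₀ − u₁| ≤ |ϖ|^ρ`):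
* §1 slot 1 (key `(m, L, m)`, `g_α` the deeper approximant): `u₀·f·g_α + u₁·g_β = u₁·G + (u₀ − u₁)·f·g_α`, `G = f·g_α + g_β`; if `G ≠ 0` and `|ϖ|^ρ·|g_α| ≤ |ϖ|^{2d−1}·|G|`
  (DEEP: `|g_α| ≤ |ϖ|^{2d−1}|g_β|`; BOUNDARY: `|g_α| = |ϖ|^{2d−2}|g_β|`, `ρ ≥ 1`) then `ω(u₀·f·g_α + u₁·g_β) = ω(f·g_α + g_β)·ω(u₁)` (`normSign_twoSlot_eq_of_near₂`).
* §2 slot 0 (key `(L, m, m)`, `g_β` the deeper approximant): `u₀·f·g_α + u₁·g_β = u₀·G + (u₁ − u₀)·g_β`; if `G ≠ 0` and `|ϖ|^ρ·|g_β| ≤ |ϖ|^{2d−1}·|G|` then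
  `ω(u₀·f·g_α + u₁·g_β) = ω(f·g_α + g_β)·ω(u₀)` (`normSign_twoSlot_eq_of_near₁`).
* §3 the per-lattice values (★ FILE 4a `…_eq_of_collapse` at `k = 1`, `k = 0`): `labelledOddCount_div_relIndex_coreHanging_eq_of_near₂ ∕ ₁`.
HONEST LABEL.  Count-neutral (`--supports`); the boundary stratum sums for these keys (FILE 4f∕4g), the shallow keys, `hRest`, (T3), (β-BAL), (β), T₊ stay OPEN; `HC_CM` is proved only modulo
the 7 printed citations (2 remaining named inputs: hLiu418 = `stmt-HodgeConjecture-24832`, h413 = `stmt-HodgeConjecture-24833`) until rung 0 closes.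

## References
* [Kottwitz1986BaseChangeUnits] R. E. Kottwitz, *Base change for unit elements of Hecke algebras*, Compositio Math. 60 (1986), §1 pp. 240–241 (signed lattice counts modulo the torus).
* [LanglandsShelstad1987] R. P. Langlands, D. Shelstad, *On the definition of transfer factors*, Math. Ann. 278 (1987), §3.
* [Rogawski1990] J. D. Rogawski, *Automorphic Representations of Unitary Groups in Three Variables*, Ann. of Math. Stud. 123 (1990), §4.9 Prop. 4.9.1 (a)(b) p. 55, §4.10 p. 58.
* [Serre1979] J.-P. Serre, *Local Fields*, GTM 67 (1979), Ch. V §3 Cor. 3, Ch. XV §2 (the conductor of the quadratic character).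
-/

set_option autoImplicit false

noncomputable section

namespace Summit.HodgeConjecture.HodgeConjecture.Cruxes.H413.F0P3cDyRamLabelledOddCoreHangingCollapsedReadSides


open Matrix WithZero
open Literature.NumberTheory.Automorphic Literature.NumberTheory.Automorphic.HermitianLattice Literature.NumberTheory.Automorphic.UnitaryGroup
open Literature.NumberTheory.Automorphic.UnitaryLatticeTree Literature.NumberTheory.Automorphic.UnitaryThreeFourFrame
open Literature.NumberTheory.LocalFields Literature.NumberTheory.LocalFields.WildQuadraticDatum
open Summit.HodgeConjecture.HodgeConjecture.Cruxes.H413.F0P3cDyRamFourFramePieces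
open Summit.HodgeConjecture.HodgeConjecture.Cruxes.H413.F0P3cDyRamFourFrameCensusDefs
open Summit.HodgeConjecture.HodgeConjecture.Cruxes.H413.F0P3cDyRamDiagonalTorusDefs
open Summit.HodgeConjecture.HodgeConjecture.Cruxes.H413.F0P3cDyRamLabelledOddCountDefs
open Summit.HodgeConjecture.HodgeConjecture.Cruxes.H413.F0P3cDyRamTwoSlotLabelReadCoreHanging (valueClassLabel_latt_coreHanging_iff_normSign_linear)
open Summit.HodgeConjecture.HodgeConjecture.Cruxes.H413.F0P3cDyRamLabelledOddOneSlotRead (labelledOddCount_div_relIndex_eq_of_oneSlot)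
open Summit.HodgeConjecture.HodgeConjecture.Cruxes.H413.F0P3cDyRamDiagonalKappaCoreHangingClass
open Summit.HodgeConjecture.HodgeConjecture.Cruxes.H413.F0P3cDyRamDiagonalCoreHangingPolarisationExplicit
open Summit.HodgeConjecture.HodgeConjecture.Cruxes.H413.F0P3cDyRamDiagonalGluedFixedStabiliser (mem_fixedUnitStabilizer_latt_glued_iff)
open Summit.HodgeConjecture.HodgeConjecture.Cruxes.H413.F0P3cDyRamDiagonalOrbitFibreTransport (fibre_isCoset_zero)
open Summit.HodgeConjecture.HodgeConjecture.Cruxes.H413.F0P3cDyRamDiagonalOrbitFibreCountHeads (finite_unitTorus_orbit_of_mem_normalisedStableLattices)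
open Summit.HodgeConjecture.HodgeConjecture.Cruxes.H413.F0P3cDyRamDiagonalCoreHangingCount (isNormalisedLattice_latt_coreHanging)
open Summit.HodgeConjecture.HodgeConjecture.Cruxes.H413.F0P3cDyRamStableCountTypeZero (v_diag_eq_one diag_regular)
open Summit.HodgeConjecture.HodgeConjecture.Cruxes.H413.F0P3cDyRamDiagonalKappaSplitCountEval (normSign_mul_self)
open scoped Valued WithZero Matrix MatrixGroups

open Summit.HodgeConjecture.HodgeConjecture.Cruxes.H413.F0P3cDyRamLabelledOddCoreHangingCollapsedRead (labelledOddCount_div_relIndex_coreHanging_eq_of_collapse)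

variable {K : Type} [Field K] [Valued K ℤᵐ⁰]

/-! ## §1  Slot 1: the key `(m, L, m)` (the `α`-approximant is the deeper one) -/

/-- **COLLAPSE IN SLOT 1, DEEP OR BOUNDARY** (key `(m, L, m)`).  Ramified datum on a complete field; core-hanging member `M = latt(1 0 0; x ϖ^ρ 0; xζ+f·xζ ϖ^ρζ ϖ^{2ρ})` (`x, ζ` units, `f` a
fixed unit); fixed `g_α, g_β` with `G := f·g_α + g_β ≠ 0` and the smallness letter `|ϖ|^ρ·|g_α| ≤ |ϖ|^{2d−1}·|G|`.  Then for every `u ∈ S_F(M)`: `u₀·f·g_α + u₁·g_β ≠ 0` and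
`normSign σ (u₀·f·g_α + u₁·g_β) = normSign σ (f·g_α + g_β) · normSign σ u_1` (★ `S_F` letters ⇒ `|u₀ − u₁| ≤ |ϖ|^ρ`; ★ toolkit §3–§4).
[cite: Serre1979, Ch. XV §2] [cite: Kottwitz1986BaseChangeUnits, §1 pp. 240–241] -/
theorem normSign_twoSlot_eq_of_near₂ [CompleteSpace K] [Finite 𝓀[K]] {σ : K →+* K} {ϖ : K} {d t : ℕ} (hD : IsRamifiedQuadraticDatum σ ϖ d t)
    {ρ : ℕ} {x ζ f : K} (hx : Valued.v x = 1) (hζ : Valued.v ζ = 1) (hσf : σ f = f) (hf : Valued.v f = 1)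
    (V : GL (Fin 3) K) (hV : (V : Matrix (Fin 3) (Fin 3) K) = !![1, 0, 0; x, ϖ ^ ρ, 0; x * ζ + f * (x * ζ), ϖ ^ ρ * ζ, ϖ ^ (2 * ρ)])
    {gα gβ : K} (hσgα : σ gα = gα) (hσgβ : σ gβ = gβ) (hG0 : f * gα + gβ ≠ 0)
    (hdom : Valued.v ϖ ^ ρ * Valued.v gα ≤ Valued.v ϖ ^ (2 * d - 1) * Valued.v (f * gα + gβ))
    {u : Fin 3 → Kˣ} (hu : u ∈ fixedUnitStabilizer σ (latt (V : Matrix (Fin 3) (Fin 3) K))) :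
    ((u 0 : Kˣ) : K) * f * gα + ((u 1 : Kˣ) : K) * gβ ≠ 0 ∧
      normSign σ (((u 0 : Kˣ) : K) * f * gα + ((u 1 : Kˣ) : K) * gβ) = normSign σ (f * gα + gβ) * normSign σ ((u 1 : Kˣ) : K) := by
  obtain ⟨hσ, hvσ, hϖ, hfix, hdd, hd1, -⟩ := id hD
  have hϖ0 : ϖ ≠ 0 := fun h => by rw [h, map_zero] at hϖ; exact (exp_ne_zero hϖ.symm).elim
  have hϖ1 : Valued.v ϖ ≤ 1 := by rw [hϖ, ← exp_zero, exp_le_exp]; norm_num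
  have hf0 : f ≠ 0 := fun h => by rw [h, map_zero] at hf; exact zero_ne_one hf
  have huT : u ∈ fixedUnitTorus σ 3 := hu.2
  have hufix : ∀ j, σ ((u j : Kˣ) : K) = u j := fun j => ((mem_fixedUnitTorus_iff σ u).1 huT).2 j
  have huv : ∀ j, Valued.v ((u j : Kˣ) : K) = 1 := fun j => ((mem_fixedUnitTorus_iff σ u).1 huT).1 j
  -- the ★ `S_F` letters at `s = 0` with lineariser `1∕f`, and `|u₀ − u₁| ≤ |ϖ|^ρ`
  have hV0 : (V : Matrix (Fin 3) (Fin 3) K) = !![1, 0, 0; x, ϖ ^ ρ, 0; x * ζ + f * (x * ζ), ϖ ^ ρ * ζ, ϖ ^ (2 * ρ + 0)] := by rw [Nat.add_zero]; exact hV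
  have hmem := (mem_fixedUnitStabilizer_latt_glued_iff (σ := σ) hϖ0 hϖ1 ρ 0 (x := x) (ζ := ζ) (y'' := f * (x * ζ)) (g := f⁻¹) hx hζ
    (by rw [pow_zero, map_mul, map_mul, hf, hx, hζ, one_mul, one_mul]) (by rw [pow_zero, mul_one, map_inv₀, hf, inv_one])
    (by rw [show x * ζ - f⁻¹ * (f * (x * ζ)) = 0 by rw [← mul_assoc, inv_mul_cancel₀ hf0, one_mul, sub_self], map_zero]; exact zero_le) V hV0 huT).1 hu
  obtain ⟨h10, h20⟩ := hmem
  rw [Nat.add_zero] at h10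
  have h02 : Valued.v (((u 2 : Kˣ) : K) - u 0) ≤ Valued.v ϖ ^ ρ := by
    have e : ((u 2 : Kˣ) : K) - u 0 = (f⁻¹ * (((u 2 : Kˣ) : K) - u 1) + (((u 2 : Kˣ) : K) - u 0)) + -(f⁻¹ * (((u 2 : Kˣ) : K) - u 1)) := by ring
    rw [e]
    refine (Valuation.map_add _ _ _).trans (max_le (h20.trans (pow_le_pow_right_of_le_one' hϖ1 (by omega))) ?_)
    rw [Valuation.map_neg, map_mul, map_inv₀, hf, inv_one, one_mul]; exact h10
  have h01 : Valued.v (((u 0 : Kˣ) : K) - u 1) ≤ Valued.v ϖ ^ ρ := by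
    rw [show ((u 0 : Kˣ) : K) - u 1 = (((u 2 : Kˣ) : K) - u 1) - (((u 2 : Kˣ) : K) - u 0) by ring]
    exact (Valuation.map_sub _ _ _).trans (max_le h10 h02)
  -- the decomposition `u₀ f g_α + u₁ g_β = u_k·G + E`
  obtain ⟨E, hE⟩ : ∃ E : K, E = (((u 0 : Kˣ) : K) - u 1) * f * gα := ⟨_, rfl⟩
  have hdec : ((u 0 : Kˣ) : K) * f * gα + ((u 1 : Kˣ) : K) * gβ = ((u 1 : Kˣ) : K) * (f * gα + gβ) + E := by rw [hE]; ring
  have hvG : 0 < Valued.v (f * gα + gβ) := (Valuation.pos_iff _).2 hG0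
  have hEle : Valued.v E ≤ Valued.v ϖ ^ (2 * d - 1) * Valued.v (f * gα + gβ) := by
    rw [hE, map_mul, map_mul, hf, mul_one]
    exact (mul_le_mul' h01 le_rfl).trans hdom
  -- `y := 1 + E∕(u_k G)` is a fixed unit with `|y − 1| ≤ |ϖ|^{2d−1}`, hence a norm
  have huk0 : ((u 1 : Kˣ) : K) ≠ 0 := (u 1).ne_zero
  have hW0 : ((u 1 : Kˣ) : K) * (f * gα + gβ) ≠ 0 := mul_ne_zero huk0 hG0
  obtain ⟨y, hy⟩ : ∃ y : K, y = 1 + E / (((u 1 : Kˣ) : K) * (f * gα + gβ)) := ⟨_, rfl⟩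
  have hσG : σ (f * gα + gβ) = f * gα + gβ := by rw [map_add, map_mul, hσf, hσgα, hσgβ]
  have hσE : σ E = E := by rw [hE]; simp only [map_mul, map_sub, hσf, hufix, hσgα]
  have hσy : σ y = y := by rw [hy, map_add, map_one, map_div₀, hσE, map_mul, hufix, hσG]
  have hy1 : Valued.v (y - 1) ≤ Valued.v ϖ ^ (2 * d - 1) := by
    rw [hy, add_sub_cancel_left, map_div₀, map_mul, huv, one_mul, div_le_iff₀ hvG]
    exact hEle
  have hωy : normSign σ y = 1 := normSign_eq_one_of_fixed_of_v_sub_one_le hD hσy le_rfl hy1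
  have hlt : Valued.v ϖ ^ (2 * d - 1) < 1 := pow_lt_one₀ zero_le (by rw [hϖ, ← exp_zero, exp_lt_exp]; norm_num) (by omega)
  have hvy : Valued.v y = 1 := by
    have e : y = 1 + (y - 1) := by ring
    rw [e]; exact Valuation.map_one_add_of_lt _ (hy1.trans_lt hlt)
  have hy0 : y ≠ 0 := fun h0 => by rw [h0, map_zero] at hvy; exact zero_ne_one hvy
  have hfac : ((u 0 : Kˣ) : K) * f * gα + ((u 1 : Kˣ) : K) * gβ = (((u 1 : Kˣ) : K) * (f * gα + gβ)) * y := by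
    have e : (((u 1 : Kˣ) : K) * (f * gα + gβ)) * y = ((u 1 : Kˣ) : K) * (f * gα + gβ) + E := by
      rw [hy, mul_add, mul_one, mul_div_cancel₀ _ hW0]
    rw [e]; exact hdec
  refine ⟨by rw [hfac]; exact mul_ne_zero hW0 hy0, ?_⟩
  rw [hfac, normSign_mul_of_fixed hD (by rw [map_mul, hufix, hσG]) hσy hW0 hy0, hωy, mul_one,
    normSign_mul_of_fixed hD (hufix 1) hσG huk0 hG0, mul_comm]

/-! ## §2  Slot 0: the key `(L, m, m)` (the `β`-approximant is the deeper one) -/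

/-- **COLLAPSE IN SLOT 0, DEEP OR BOUNDARY** (key `(L, m, m)`).  Ramified datum on a complete field; core-hanging member `M = latt(1 0 0; x ϖ^ρ 0; xζ+f·xζ ϖ^ρζ ϖ^{2ρ})` (`x, ζ` units, `f` a
fixed unit); fixed `g_α, g_β` with `G := f·g_α + g_β ≠ 0` and the smallness letter `|ϖ|^ρ·|g_β| ≤ |ϖ|^{2d−1}·|G|`.  Then for every `u ∈ S_F(M)`: `u₀·f·g_α + u₁·g_β ≠ 0` and
`normSign σ (u₀·f·g_α + u₁·g_β) = normSign σ (f·g_α + g_β) · normSign σ u_0` (★ `S_F` letters ⇒ `|u₀ − u₁| ≤ |ϖ|^ρ`; ★ toolkit §3–§4).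
[cite: Serre1979, Ch. XV §2] [cite: Kottwitz1986BaseChangeUnits, §1 pp. 240–241] -/
theorem normSign_twoSlot_eq_of_near₁ [CompleteSpace K] [Finite 𝓀[K]] {σ : K →+* K} {ϖ : K} {d t : ℕ} (hD : IsRamifiedQuadraticDatum σ ϖ d t)
    {ρ : ℕ} {x ζ f : K} (hx : Valued.v x = 1) (hζ : Valued.v ζ = 1) (hσf : σ f = f) (hf : Valued.v f = 1)
    (V : GL (Fin 3) K) (hV : (V : Matrix (Fin 3) (Fin 3) K) = !![1, 0, 0; x, ϖ ^ ρ, 0; x * ζ + f * (x * ζ), ϖ ^ ρ * ζ, ϖ ^ (2 * ρ)])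
    {gα gβ : K} (hσgα : σ gα = gα) (hσgβ : σ gβ = gβ) (hG0 : f * gα + gβ ≠ 0)
    (hdom : Valued.v ϖ ^ ρ * Valued.v gβ ≤ Valued.v ϖ ^ (2 * d - 1) * Valued.v (f * gα + gβ))
    {u : Fin 3 → Kˣ} (hu : u ∈ fixedUnitStabilizer σ (latt (V : Matrix (Fin 3) (Fin 3) K))) :
    ((u 0 : Kˣ) : K) * f * gα + ((u 1 : Kˣ) : K) * gβ ≠ 0 ∧
      normSign σ (((u 0 : Kˣ) : K) * f * gα + ((u 1 : Kˣ) : K) * gβ) = normSign σ (f * gα + gβ) * normSign σ ((u 0 : Kˣ) : K) := by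
  obtain ⟨hσ, hvσ, hϖ, hfix, hdd, hd1, -⟩ := id hD
  have hϖ0 : ϖ ≠ 0 := fun h => by rw [h, map_zero] at hϖ; exact (exp_ne_zero hϖ.symm).elim
  have hϖ1 : Valued.v ϖ ≤ 1 := by rw [hϖ, ← exp_zero, exp_le_exp]; norm_num
  have hf0 : f ≠ 0 := fun h => by rw [h, map_zero] at hf; exact zero_ne_one hf
  have huT : u ∈ fixedUnitTorus σ 3 := hu.2
  have hufix : ∀ j, σ ((u j : Kˣ) : K) = u j := fun j => ((mem_fixedUnitTorus_iff σ u).1 huT).2 j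
  have huv : ∀ j, Valued.v ((u j : Kˣ) : K) = 1 := fun j => ((mem_fixedUnitTorus_iff σ u).1 huT).1 j
  -- the ★ `S_F` letters at `s = 0` with lineariser `1∕f`, and `|u₀ − u₁| ≤ |ϖ|^ρ`
  have hV0 : (V : Matrix (Fin 3) (Fin 3) K) = !![1, 0, 0; x, ϖ ^ ρ, 0; x * ζ + f * (x * ζ), ϖ ^ ρ * ζ, ϖ ^ (2 * ρ + 0)] := by rw [Nat.add_zero]; exact hV
  have hmem := (mem_fixedUnitStabilizer_latt_glued_iff (σ := σ) hϖ0 hϖ1 ρ 0 (x := x) (ζ := ζ) (y'' := f * (x * ζ)) (g := f⁻¹) hx hζ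
    (by rw [pow_zero, map_mul, map_mul, hf, hx, hζ, one_mul, one_mul]) (by rw [pow_zero, mul_one, map_inv₀, hf, inv_one])
    (by rw [show x * ζ - f⁻¹ * (f * (x * ζ)) = 0 by rw [← mul_assoc, inv_mul_cancel₀ hf0, one_mul, sub_self], map_zero]; exact zero_le) V hV0 huT).1 hu
  obtain ⟨h10, h20⟩ := hmem
  rw [Nat.add_zero] at h10
  have h02 : Valued.v (((u 2 : Kˣ) : K) - u 0) ≤ Valued.v ϖ ^ ρ := by
    have e : ((u 2 : Kˣ) : K) - u 0 = (f⁻¹ * (((u 2 : Kˣ) : K) - u 1) + (((u 2 : Kˣ) : K) - u 0)) + -(f⁻¹ * (((u 2 : Kˣ) : K) - u 1)) := by ring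
    rw [e]
    refine (Valuation.map_add _ _ _).trans (max_le (h20.trans (pow_le_pow_right_of_le_one' hϖ1 (by omega))) ?_)
    rw [Valuation.map_neg, map_mul, map_inv₀, hf, inv_one, one_mul]; exact h10
  have h01 : Valued.v (((u 0 : Kˣ) : K) - u 1) ≤ Valued.v ϖ ^ ρ := by
    rw [show ((u 0 : Kˣ) : K) - u 1 = (((u 2 : Kˣ) : K) - u 1) - (((u 2 : Kˣ) : K) - u 0) by ring]
    exact (Valuation.map_sub _ _ _).trans (max_le h10 h02)
  -- the decomposition `u₀ f g_α + u₁ g_β = u_k·G + E`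
  obtain ⟨E, hE⟩ : ∃ E : K, E = (((u 1 : Kˣ) : K) - u 0) * gβ := ⟨_, rfl⟩
  have hdec : ((u 0 : Kˣ) : K) * f * gα + ((u 1 : Kˣ) : K) * gβ = ((u 0 : Kˣ) : K) * (f * gα + gβ) + E := by rw [hE]; ring
  have hvG : 0 < Valued.v (f * gα + gβ) := (Valuation.pos_iff _).2 hG0
  have hEle : Valued.v E ≤ Valued.v ϖ ^ (2 * d - 1) * Valued.v (f * gα + gβ) := by
    rw [hE, map_mul, Valuation.map_sub_swap]
    exact (mul_le_mul' h01 le_rfl).trans hdom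
  -- `y := 1 + E∕(u_k G)` is a fixed unit with `|y − 1| ≤ |ϖ|^{2d−1}`, hence a norm
  have huk0 : ((u 0 : Kˣ) : K) ≠ 0 := (u 0).ne_zero
  have hW0 : ((u 0 : Kˣ) : K) * (f * gα + gβ) ≠ 0 := mul_ne_zero huk0 hG0
  obtain ⟨y, hy⟩ : ∃ y : K, y = 1 + E / (((u 0 : Kˣ) : K) * (f * gα + gβ)) := ⟨_, rfl⟩
  have hσG : σ (f * gα + gβ) = f * gα + gβ := by rw [map_add, map_mul, hσf, hσgα, hσgβ]
  have hσE : σ E = E := by rw [hE]; simp only [map_mul, map_sub, hufix, hσgβ]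
  have hσy : σ y = y := by rw [hy, map_add, map_one, map_div₀, hσE, map_mul, hufix, hσG]
  have hy1 : Valued.v (y - 1) ≤ Valued.v ϖ ^ (2 * d - 1) := by
    rw [hy, add_sub_cancel_left, map_div₀, map_mul, huv, one_mul, div_le_iff₀ hvG]
    exact hEle
  have hωy : normSign σ y = 1 := normSign_eq_one_of_fixed_of_v_sub_one_le hD hσy le_rfl hy1
  have hlt : Valued.v ϖ ^ (2 * d - 1) < 1 := pow_lt_one₀ zero_le (by rw [hϖ, ← exp_zero, exp_lt_exp]; norm_num) (by omega)
  have hvy : Valued.v y = 1 := by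
    have e : y = 1 + (y - 1) := by ring
    rw [e]; exact Valuation.map_one_add_of_lt _ (hy1.trans_lt hlt)
  have hy0 : y ≠ 0 := fun h0 => by rw [h0, map_zero] at hvy; exact zero_ne_one hvy
  have hfac : ((u 0 : Kˣ) : K) * f * gα + ((u 1 : Kˣ) : K) * gβ = (((u 0 : Kˣ) : K) * (f * gα + gβ)) * y := by
    have e : (((u 0 : Kˣ) : K) * (f * gα + gβ)) * y = ((u 0 : Kˣ) : K) * (f * gα + gβ) + E := by
      rw [hy, mul_add, mul_one, mul_div_cancel₀ _ hW0]
    rw [e]; exact hdec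
  refine ⟨by rw [hfac]; exact mul_ne_zero hW0 hy0, ?_⟩
  rw [hfac, normSign_mul_of_fixed hD (by rw [map_mul, hufix, hσG]) hσy hW0 hy0, hωy, mul_one,
    normSign_mul_of_fixed hD (hufix 0) hσG huk0 hG0, mul_comm]

/-! ## §3  The per-lattice values (FILE 4a's collapsed read at `k = 1`, `k = 0`) -/

/-- **THE PER-LATTICE VALUE, KEY `(m, L, m)`, DEEP OR BOUNDARY** (★ FILE 4a `…_eq_of_collapse` at `k = 1` with §1):
`labelledOddCount σ ϖ 0 i Λ M ∕ [𝒰 : N(S̃(M))] = stabiliserWeight σ M ∕ 2 · (ω(f), 1, ω(−(1+f)))_i · ω(f·g_α + g_β) · [i = 1 ∨ 2d−1 ≤ ρ]`.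
[cite: Kottwitz1986BaseChangeUnits, §1 pp. 240–241] [cite: LanglandsShelstad1987, §3] [cite: Rogawski1990, §4.9 Prop. 4.9.1 (a)(b) p. 55, §4.10 p. 58] -/
theorem labelledOddCount_div_relIndex_coreHanging_eq_of_near₂ [CompleteSpace K] [Finite 𝓀[K]] {σ : K →+* K} {ϖ : K} {d t : ℕ}
    (hD : IsRamifiedQuadraticDatum σ ϖ d t) (h2 : Valued.v (2 : K) < 1)
    {ρ : ℕ} (hρ : 1 ≤ ρ) {x ζ f : K} (hx : Valued.v x = 1) (hζ : Valued.v ζ = 1) (hσf : σ f = f) (hf : Valued.v f = 1) (h1f : Valued.v (1 + f) = 1)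
    (V : GL (Fin 3) K) (hV : (V : Matrix (Fin 3) (Fin 3) K) = !![1, 0, 0; x, ϖ ^ ρ, 0; x * ζ + f * (x * ζ), ϖ ^ ρ * ζ, ϖ ^ (2 * ρ)])
    {α β : K} {N₀ n₁ n₂ n₃ : ℕ} (hE : IsElementDatum σ ϖ N₀ α β n₁ n₂ n₃) {mc : ℕ} (hℓN : d % 2 + 1 ≤ N₀) (hmN : d % 2 + 2 * d - 1 ≤ N₀)
    (hℓmc : 2 * (d % 2) + 1 ≤ mc) (hmmc : d % 2 + 2 * d - 1 + d % 2 ≤ mc)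
    {T : GL (Fin 3) K} (hT : (T : Matrix (Fin 3) (Fin 3) K) = Matrix.diagonal ![α, β, 1]) (hM0 : latt (V : Matrix (Fin 3) (Fin 3) K) ∈ normalisedStableLattices T)
    (hlev : LatticeInLevel ϖ (d % 2) (Matrix.diagonal ![α - 1, β - 1, 0]) (latt (V : Matrix (Fin 3) (Fin 3) K)))
    (hnlev : ¬ LatticeInLevel ϖ (d % 2 + 1) (Matrix.diagonal ![α - 1, β - 1, 0]) (latt (V : Matrix (Fin 3) (Fin 3) K)))
    (hsq : LatticeInLevel ϖ mc (Matrix.diagonal ![(α - 1) * (α - 1), (β - 1) * (β - 1), 0]) (latt (V : Matrix (Fin 3) (Fin 3) K)))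
    {gα gβ : K} (hσgα : σ gα = gα) (hσgβ : σ gβ = gβ) (hG0 : f * gα + gβ ≠ 0)
    (hdom : Valued.v ϖ ^ ρ * Valued.v gα ≤ Valued.v ϖ ^ (2 * d - 1) * Valued.v (f * gα + gβ))
    (hgα : Valued.v ((ϖ ^ (d % 2 + 2 * d - 1))⁻¹ * (((ϖ * σ ϖ) ^ ρ)⁻¹ * ((α - 1) - gα * ((ϖ - σ ϖ) * ((ϖ * σ ϖ) ^ ((d - d % 2) / 2))⁻¹)))) ≤ 1)
    (hgβ : Valued.v ((ϖ ^ (d % 2 + 2 * d - 1))⁻¹ * (((ϖ * σ ϖ) ^ ρ)⁻¹ * ((β - 1) - gβ * ((ϖ - σ ϖ) * ((ϖ * σ ϖ) ^ ((d - d % 2) / 2))⁻¹)))) ≤ 1)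
    (i : Fin 3) :
    (labelledOddCount σ ϖ 0 i (valueClassLabel σ ϖ (α - 1) (β - 1) (d % 2 + 2 * d - 1) d) (latt (V : Matrix (Fin 3) (Fin 3) K)) : ℚ) /
        ((((unitStabilizer (latt (V : Matrix (Fin 3) (Fin 3) K))).map (unitNormMap σ 3)).relIndex (fixedUnitTorus σ 3) : ℕ) : ℚ) =
      stabiliserWeight σ (latt (V : Matrix (Fin 3) (Fin 3) K)) / 2 *
        ((((![normSign σ f, 1, normSign σ (-(1 + f))] : Fin 3 → ℤ) i * normSign σ (f * gα + gβ) * (if i = 1 ∨ 2 * d - 1 ≤ ρ then 1 else 0) : ℤ)) : ℚ) :=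
  labelledOddCount_div_relIndex_coreHanging_eq_of_collapse hD h2 hρ hx hζ hσf hf h1f V hV hE hℓN hmN hℓmc hmmc hT hM0 hlev hnlev hsq hσgα hσgβ hgα hgβ 1
    (by unfold normSign; split_ifs <;> simp) (fun u hu => normSign_twoSlot_eq_of_near₂ hD hx hζ hσf hf V hV hσgα hσgβ hG0 hdom hu) i

/-- **THE PER-LATTICE VALUE, KEY `(L, m, m)`, DEEP OR BOUNDARY** (★ FILE 4a `…_eq_of_collapse` at `k = 0` with §2):
`labelledOddCount σ ϖ 0 i Λ M ∕ [𝒰 : N(S̃(M))] = stabiliserWeight σ M ∕ 2 · (ω(f), 1, ω(−(1+f)))_i · ω(f·g_α + g_β) · [i = 0 ∨ 2d−1 ≤ ρ]`.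
[cite: Kottwitz1986BaseChangeUnits, §1 pp. 240–241] [cite: LanglandsShelstad1987, §3] [cite: Rogawski1990, §4.9 Prop. 4.9.1 (a)(b) p. 55, §4.10 p. 58] -/
theorem labelledOddCount_div_relIndex_coreHanging_eq_of_near₁ [CompleteSpace K] [Finite 𝓀[K]] {σ : K →+* K} {ϖ : K} {d t : ℕ}
    (hD : IsRamifiedQuadraticDatum σ ϖ d t) (h2 : Valued.v (2 : K) < 1)
    {ρ : ℕ} (hρ : 1 ≤ ρ) {x ζ f : K} (hx : Valued.v x = 1) (hζ : Valued.v ζ = 1) (hσf : σ f = f) (hf : Valued.v f = 1) (h1f : Valued.v (1 + f) = 1)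
    (V : GL (Fin 3) K) (hV : (V : Matrix (Fin 3) (Fin 3) K) = !![1, 0, 0; x, ϖ ^ ρ, 0; x * ζ + f * (x * ζ), ϖ ^ ρ * ζ, ϖ ^ (2 * ρ)])
    {α β : K} {N₀ n₁ n₂ n₃ : ℕ} (hE : IsElementDatum σ ϖ N₀ α β n₁ n₂ n₃) {mc : ℕ} (hℓN : d % 2 + 1 ≤ N₀) (hmN : d % 2 + 2 * d - 1 ≤ N₀)
    (hℓmc : 2 * (d % 2) + 1 ≤ mc) (hmmc : d % 2 + 2 * d - 1 + d % 2 ≤ mc)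
    {T : GL (Fin 3) K} (hT : (T : Matrix (Fin 3) (Fin 3) K) = Matrix.diagonal ![α, β, 1]) (hM0 : latt (V : Matrix (Fin 3) (Fin 3) K) ∈ normalisedStableLattices T)
    (hlev : LatticeInLevel ϖ (d % 2) (Matrix.diagonal ![α - 1, β - 1, 0]) (latt (V : Matrix (Fin 3) (Fin 3) K)))
    (hnlev : ¬ LatticeInLevel ϖ (d % 2 + 1) (Matrix.diagonal ![α - 1, β - 1, 0]) (latt (V : Matrix (Fin 3) (Fin 3) K)))
    (hsq : LatticeInLevel ϖ mc (Matrix.diagonal ![(α - 1) * (α - 1), (β - 1) * (β - 1), 0]) (latt (V : Matrix (Fin 3) (Fin 3) K)))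
    {gα gβ : K} (hσgα : σ gα = gα) (hσgβ : σ gβ = gβ) (hG0 : f * gα + gβ ≠ 0)
    (hdom : Valued.v ϖ ^ ρ * Valued.v gβ ≤ Valued.v ϖ ^ (2 * d - 1) * Valued.v (f * gα + gβ))
    (hgα : Valued.v ((ϖ ^ (d % 2 + 2 * d - 1))⁻¹ * (((ϖ * σ ϖ) ^ ρ)⁻¹ * ((α - 1) - gα * ((ϖ - σ ϖ) * ((ϖ * σ ϖ) ^ ((d - d % 2) / 2))⁻¹)))) ≤ 1)
    (hgβ : Valued.v ((ϖ ^ (d % 2 + 2 * d - 1))⁻¹ * (((ϖ * σ ϖ) ^ ρ)⁻¹ * ((β - 1) - gβ * ((ϖ - σ ϖ) * ((ϖ * σ ϖ) ^ ((d - d % 2) / 2))⁻¹)))) ≤ 1)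
    (i : Fin 3) :
    (labelledOddCount σ ϖ 0 i (valueClassLabel σ ϖ (α - 1) (β - 1) (d % 2 + 2 * d - 1) d) (latt (V : Matrix (Fin 3) (Fin 3) K)) : ℚ) /
        ((((unitStabilizer (latt (V : Matrix (Fin 3) (Fin 3) K))).map (unitNormMap σ 3)).relIndex (fixedUnitTorus σ 3) : ℕ) : ℚ) =
      stabiliserWeight σ (latt (V : Matrix (Fin 3) (Fin 3) K)) / 2 *
        ((((![normSign σ f, 1, normSign σ (-(1 + f))] : Fin 3 → ℤ) i * normSign σ (f * gα + gβ) * (if i = 0 ∨ 2 * d - 1 ≤ ρ then 1 else 0) : ℤ)) : ℚ) :=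
  labelledOddCount_div_relIndex_coreHanging_eq_of_collapse hD h2 hρ hx hζ hσf hf h1f V hV hE hℓN hmN hℓmc hmmc hT hM0 hlev hnlev hsq hσgα hσgβ hgα hgβ 0
    (by unfold normSign; split_ifs <;> simp) (fun u hu => normSign_twoSlot_eq_of_near₁ hD hx hζ hσf hf V hV hσgα hσgβ hG0 hdom hu) i

end Summit.HodgeConjecture.HodgeConjecture.Cruxes.H413.F0P3cDyRamLabelledOddCoreHangingCollapsedReadSides

end
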